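import Mathlib
import Summits.CriticalPhenomena.CardyFormulaZ2.Theorems.CardyMagicRigidityNestingRigiditySoftMachineTameAssembly
import Summits.CriticalPhenomena.CardyFormulaZ2.Theorems.CardyMagicRigidityNestingRigidityPrecompactnessDust
import HarnessLib

/-!
# Soft machine, brick 15: `TamePrecompact tEns` from tameness + separation of limit loops and LATTICE dust density

Crux `Summit.CriticalPhenomena.CardyFormulaZ2.Theses.CardyMagicRigidity.NestingRigidity`
(stmt-CriticalPhenomena-4835), line `positive-cone-weight-doubling`, registered stub `stub_tamePrecompactness :
TamePrecompact zEns ∧ TamePrecompact tEns`.  Brick 14 (`tamePrecompact_tEns_of_ae_tame_separating_dust`) chained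
with the dust reduction `ae_dust_of_tendsto_cnLawEDist` (p129890): the dust field (D) of the limit samples is
replaced by the pure LATTICE statement (Dlat) "mesoscopic loop density of `tEns`" (for every window `B̄(0, R)`,
radius `r` and `κ > 0` there is `d > 0` such that for all small meshes, off an event of probability `≤ κ`, every
disc `B(z, r')`, `z ∈ B̄(0, R)`, `r' ≥ r/2`, contains a loop of each type of diameter `≥ d`).  So
`TamePrecompact tEns` ⇐ (T) a.s. tameness of the non-point limit loops ∧ (S) a.s. separation of limit loops ∧
(Dlat) — `tamePrecompact_tEns_of_ae_tame_separating_of_latticeDust` (registered anchor); `zEns` copy given the bond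
multiple-traversal estimate.
-/

noncomputable section

open MeasureTheory Set Filter Metric TopologicalSpace Function
open scoped Topology ENNReal NNReal unitInterval

namespace Summit.CriticalPhenomena.CardyFormulaZ2.Cruxes.NestingRigidity.PositiveConeWeightDoubling

open Literature.Probability.RandomPlanarGeometry Literature.Probability.Percolation
  Literature.Probability.LatticeModels
open Summit.CriticalPhenomena.CardyFormulaZ2.Cruxes.NestingRigidity.RingCloudTomography

/-- **Registered anchor** (`tamePrecompact_tEns_of_ae_tame_separating_of_latticeDust`): `TamePrecompact tEns` follows
from (T) a.s. tameness of the non-point loops and (S) a.s. separation of the non-point loops of every hit-measurable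
sequential `d_CN`-limit presentation of `tEns`, together with the LATTICE mesoscopic loop density (Dlat) of `tEns`. -/
theorem tamePrecompact_tEns_of_ae_tame_separating_of_latticeDust :
    (∀ (δs : ℕ → ℝ) (X : unitInterval → LoopConfig ℂ), Tendsto δs atTop (𝓝[>] (0 : ℝ)) →
      (∀ (i : Fin 2) (Q : Set (UnbasedLoop ℂ)), IsClosed Q → MeasurableSet {s | ∃ u ∈ (X s).F i, u ∈ Q}) →
      Tendsto (fun k : ℕ ↦ LoopConfig.cnLawEDist tEns.P (tEns.X (δs k)) volume X) atTop (𝓝 0) →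
      (∀ᵐ s : unitInterval, ∀ u ∈ (X s).loops, u.range.Nontrivial → Tame u) ∧
      (∀ᵐ s : unitInterval, ∀ u ∈ (X s).loops, ∀ v ∈ (X s).loops, u.range.Nontrivial → v.range.Nontrivial →
        {z | u.wind z ≠ 0} = {z | v.wind z ≠ 0} → u = v ∨ u = v.reverse)) →
    (∀ (R r κ : ℝ), 0 < r → 0 < κ → ∃ d : ℝ, 0 < d ∧ ∀ᶠ δ in 𝓝[>] (0 : ℝ),
      ∃ Fev : Set tEns.Ω, MeasurableSet Fev ∧ tEns.P Fev ≤ ENNReal.ofReal κ ∧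
        ∀ ω ∉ Fev, ∀ z ∈ closedBall (0 : ℂ) R, ∀ i : Fin 2, ∀ r' : ℝ, r / 2 ≤ r' →
          ∃ v ∈ (tEns.X δ ω).F i, v.range ⊆ ball z r' ∧ d ≤ diam v.range) →
    TamePrecompact tEns := by
  intro hfields hdens
  refine tamePrecompact_tEns_of_ae_tame_separating_dust fun δs X hδs hXhit hconv ↦ ?_
  obtain ⟨hT, hS⟩ := hfields δs X hδs hXhit hconv
  have hm : ∀ (k : ℕ) (ε : ℝ),
      MeasurableSet {p : tEns.Ω × unitInterval | LoopConfig.IsClose ε (tEns.X (δs k) p.1) (X p.2)} :=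
    fun k ε ↦ softMachine_measurableSet_isClose_latticeEnsembles_all tEns tEns_mem (δs k) ε unitInterval X hXhit
  exact ⟨hT, hS, ae_dust_of_tendsto_cnLawEDist tEns tEns_mem δs volume X hδs hm hconv hdens⟩

/-- The `zEns` copy, given the bond multiple-traversal estimate (H1). -/
theorem tamePrecompact_zEns_of_traversalBound_of_ae_tame_separating_of_latticeDust
    (hH1 : ∃ (k : ℕ) (K lam : ℝ), 0 ≤ K ∧ 2 < lam ∧ ∀ (M : Set (Sym2 (Site 2))) (δ : ℝ), δ ∈ Set.Ioc (0 : ℝ) 1 →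
      ∀ (x : ℂ) (ρ R : ℝ), δ ≤ ρ → ρ < R → R ≤ 1 →
        bondPercolation (zdGraph 2) half {ω | ∃ γ : List MedialVertex, IsInterfaceLoop (ω ∩ M) γ ∧
          (⟨Literature.Probability.LatticeModels.polyline ((γ ++ γ.take 1).map (medialPoint δ))⟩ : Curve ℂ).HasTraversals
            k x ρ R} ≤ ENNReal.ofReal (K * (ρ / R) ^ lam))
    (hfields : ∀ (δs : ℕ → ℝ) (X : unitInterval → LoopConfig ℂ), Tendsto δs atTop (𝓝[>] (0 : ℝ)) →
      (∀ (i : Fin 2) (Q : Set (UnbasedLoop ℂ)), IsClosed Q → MeasurableSet {s | ∃ u ∈ (X s).F i, u ∈ Q}) →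
      Tendsto (fun k : ℕ ↦ LoopConfig.cnLawEDist zEns.P (zEns.X (δs k)) volume X) atTop (𝓝 0) →
      (∀ᵐ s : unitInterval, ∀ u ∈ (X s).loops, u.range.Nontrivial → Tame u) ∧
      (∀ᵐ s : unitInterval, ∀ u ∈ (X s).loops, ∀ v ∈ (X s).loops, u.range.Nontrivial → v.range.Nontrivial →
        {z | u.wind z ≠ 0} = {z | v.wind z ≠ 0} → u = v ∨ u = v.reverse))
    (hdens : ∀ (R r κ : ℝ), 0 < r → 0 < κ → ∃ d : ℝ, 0 < d ∧ ∀ᶠ δ in 𝓝[>] (0 : ℝ),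
      ∃ Fev : Set zEns.Ω, MeasurableSet Fev ∧ zEns.P Fev ≤ ENNReal.ofReal κ ∧
        ∀ ω ∉ Fev, ∀ z ∈ closedBall (0 : ℂ) R, ∀ i : Fin 2, ∀ r' : ℝ, r / 2 ≤ r' →
          ∃ v ∈ (zEns.X δ ω).F i, v.range ⊆ ball z r' ∧ d ≤ diam v.range) :
    TamePrecompact zEns := by
  refine tamePrecompact_zEns_of_traversalBound_of_ae_tame_separating_dust hH1 fun δs X hδs hXhit hconv ↦ ?_
  obtain ⟨hT, hS⟩ := hfields δs X hδs hXhit hconv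
  have hm : ∀ (k : ℕ) (ε : ℝ),
      MeasurableSet {p : zEns.Ω × unitInterval | LoopConfig.IsClose ε (zEns.X (δs k) p.1) (X p.2)} :=
    fun k ε ↦ softMachine_measurableSet_isClose_latticeEnsembles_all zEns zEns_mem (δs k) ε unitInterval X hXhit
  exact ⟨hT, hS, ae_dust_of_tendsto_cnLawEDist zEns zEns_mem δs volume X hδs hm hconv hdens⟩

end Summit.CriticalPhenomena.CardyFormulaZ2.Cruxes.NestingRigidity.PositiveConeWeightDoubling

end
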